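import Summits.RiemannHypothesis.RiemannHypothesis.Theorems.AsymptoticCriticalLine.Negative.BandForms
import Literature.NumberTheory.LFunctions.RHWave0HardyProofs

/-!
# An interior band in Beurling's world: the rescaled zeta `ζ(2s − 1)` (Broucke 2024, Thm 6.3) (negative lemmas, cycle 3)

Barrier reduction for the crux `AsymptoticCriticalLine` (stmt-RiemannHypothesis-2063, route
RuelleBand) and for the INTERIOR half `NoInteriorBand` of card interior-edge-split, answering that
card's falsifier (F2) from print. Broucke, *On zero-density estimates for Beurling zeta functions*
(arXiv:2409.10051, Ann. Sc. Norm. Super. Pisa, to appear), §6.1 and Theorem 6.3 (read at page level,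
pp. 14–15 of the held text): for every `θ ∈ [1/2, 1)` there is a (discrete) Beurling number system
with `N_P(x) = Ax + O(x^θ (1 + 1_{θ=1/2} log x))` whose zeta function is
`ζ_P(s) = ζ_θ(s)/ζ_R(s)`, `ζ_θ(s) := ζ((s − θ)/(1 − θ))`, `ζ_R` analytic and zero-free on
`Re s > 1 − θ`; so `ζ_P` has the zeros of `ζ` RESCALED onto the interior line `σ = (1+θ)/2`, with
`N(ζ_P; (1+θ)/2, T) ∼ ((1−θ)T/2π) log((1−θ)T/2π)`. At `θ = 1/2`: integers as regular as
`O(√x log x)` and an interior band at `σ = 3/4` carrying `≍ T log T` zeros.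

Here the extended-sense system behind the construction (`θ = 1/2`: "integers `n²` with multiplicity
`n`", Broucke §6.1) is typed directly: its zeta function is `Z(s) = ζ(2s − 1) = ∑ n · (n²)^{−s}`
(`zetaRescaledHalf`, `zetaRescaledHalf_eq_tsum`), its counting function
`N(x) = ∑_{n² ≤ x} n = x/2 + O(√x)` (`rescaledCount`, `abs_rescaledCount_sub_le`), it is zero-free on
`Re s ≥ 1` like `ζ` (`zetaRescaledHalf_ne_zero_of_one_le_re`), and its level-`1/4` band is the
populated line `Re s = 3/4` (Hardy; `bandSet_zetaRescaledHalf_infinite`, `not_band_zetaRescaledHalf`).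

Consequence for the split (cf. `Split.lean`): BOTH halves of the crux are under the Beurling
barrier — the edge half by Diamond–Montgomery–Vorhauer 2006 (`θ > 1/2`, zeros on `1 − a/log t`),
the interior half by Broucke 2024 Thm 6.3 (`θ ≥ 1/2`, a full band at `(1+θ)/2`). An argument for
`NoInteriorBand`, let alone for the crux, that uses of `ℤ` only multiplicativity and
`N(x) = Ax + O(x^θ)` must use `θ < 1/2`; the card's hope that the interior half is "soft"
(Beurling-provable) is refuted in print.
-/

noncomputable section

namespace Summit.RiemannHypothesis.RiemannHypothesis.Theorems.AsymptoticCriticalLine.Negative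

open Complex Set
open Summit.RiemannHypothesis.RiemannHypothesis.Theses.RuelleBand (AsymptoticCriticalLine)

/-- The rescaled zeta function `ζ_{1/2}(s) = ζ(2s − 1)` (Broucke 2024 §6.1 with `θ = 1/2`).
[cite: Broucke2024, §6.1] -/
def zetaRescaledHalf (s : ℂ) : ℂ :=
  riemannZeta (2 * s - 1)

/-- [folklore] -/
theorem re_two_mul_sub_one (s : ℂ) : (2 * s - 1).re = 2 * s.re - 1 := by
  simp [mul_re, sub_re]

/-- Its Dirichlet series on `Re s > 1`: `ζ(2s − 1) = ∑_n n^{−(2s−1)} = ∑_n n · (n²)^{−s}` — the zeta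
function of the extended-sense Beurling system "integers `n²` with multiplicity `n`" (Mathlib
`zeta_eq_tsum_one_div_nat_cpow`). [cite: Broucke2024, §6.1] -/
theorem zetaRescaledHalf_eq_tsum {s : ℂ} (hs : 1 < s.re) :
    zetaRescaledHalf s = ∑' n : ℕ, 1 / (n : ℂ) ^ (2 * s - 1) :=
  zeta_eq_tsum_one_div_nat_cpow (by rw [re_two_mul_sub_one]; linarith)

/-- Like `ζ`, it is zero-free on `Re s ≥ 1` (its abscissa and right edge are those of `ζ`).
[folklore] -/
theorem zetaRescaledHalf_ne_zero_of_one_le_re {s : ℂ} (h : 1 ≤ s.re) : zetaRescaledHalf s ≠ 0 :=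
  riemannZeta_ne_zero_of_one_le_re (by rw [re_two_mul_sub_one]; linarith)

/-- The counting function of the system: `N(x) = ∑_{n² ≤ x} n = ∑_{i ≤ ⌊√x⌋} i`. [cite: Broucke2024, §6.1] -/
def rescaledCount (x : ℝ) : ℕ :=
  ∑ i ∈ Finset.range (⌊Real.sqrt x⌋₊ + 1), i

/-- Gauss: `2 N(x) = m(m+1)`, `m = ⌊√x⌋`. [folklore] -/
theorem two_mul_rescaledCount (x : ℝ) :
    (rescaledCount x : ℝ) * 2 = (⌊Real.sqrt x⌋₊ : ℝ) * ((⌊Real.sqrt x⌋₊ : ℝ) + 1) := by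
  have h := Finset.sum_range_id_mul_two (⌊Real.sqrt x⌋₊ + 1)
  simp only [Nat.add_sub_cancel] at h
  unfold rescaledCount
  have : ((∑ i ∈ Finset.range (⌊Real.sqrt x⌋₊ + 1), i : ℕ) : ℝ) * 2 =
      (((⌊Real.sqrt x⌋₊ + 1) * ⌊Real.sqrt x⌋₊ : ℕ) : ℝ) := by exact_mod_cast h
  rw [this]
  push_cast
  ring

/-- `θ = 1/2` REGULARITY: `|N(x) − x/2| ≤ √x` for `x ≥ 1` (so `N(x) = x/2 + O(x^{1/2})`; Broucke's
discrete system built from it has `O(√x log x)`). [cite: Broucke2024, Thm 6.3] -/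
theorem abs_rescaledCount_sub_le {x : ℝ} (hx : 1 ≤ x) :
    |(rescaledCount x : ℝ) - x / 2| ≤ Real.sqrt x := by
  set m : ℕ := ⌊Real.sqrt x⌋₊ with hm
  have hx0 : 0 ≤ x := by linarith
  have hs0 : 0 ≤ Real.sqrt x := Real.sqrt_nonneg x
  have h1 : (m : ℝ) ≤ Real.sqrt x := Nat.floor_le hs0
  have h2 : Real.sqrt x < (m : ℝ) + 1 := Nat.lt_floor_add_one _
  have hsq : Real.sqrt x * Real.sqrt x = x := Real.mul_self_sqrt hx0
  have hN : (rescaledCount x : ℝ) = (m : ℝ) * ((m : ℝ) + 1) / 2 := by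
    have := two_mul_rescaledCount x
    rw [← hm] at this
    linarith
  rw [hN, abs_le]
  have hm0 : (0 : ℝ) ≤ m := Nat.cast_nonneg m
  constructor
  · -- x/2 − m(m+1)/2 ≤ ((m+1)² − m(m+1))/2 = (m+1)/2 ≤ √x  (uses 1 ≤ √x)
    have hs1 : 1 ≤ Real.sqrt x := by rw [← Real.sqrt_one]; exact Real.sqrt_le_sqrt hx
    nlinarith
  · -- m(m+1)/2 − x/2 ≤ m/2 ≤ √x  (uses m² ≤ x)
    nlinarith

/-- The point `3/4 + (t/2) i`. [folklore] -/
def threeQuarterPt (t : ℝ) : ℂ :=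
  (((3 : ℝ) / 4 : ℝ) : ℂ) + ((t / 2 : ℝ) : ℂ) * I

/-- [folklore] -/
theorem threeQuarterPt_re (t : ℝ) : (threeQuarterPt t).re = 3 / 4 := by
  simp only [threeQuarterPt, add_re, ofReal_re, mul_re, I_re, I_im, ofReal_im, mul_zero, mul_one,
    sub_zero, add_zero]

/-- [folklore] -/
theorem threeQuarterPt_im (t : ℝ) : (threeQuarterPt t).im = t / 2 := by
  simp only [threeQuarterPt, add_im, ofReal_im, mul_im, ofReal_re, I_re, I_im, mul_zero, mul_one,
    zero_add, add_zero]

/-- `2 · (3/4 + it/2) − 1 = 1/2 + it`. [folklore] -/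
theorem two_mul_threeQuarterPt_sub_one (t : ℝ) : 2 * threeQuarterPt t - 1 = 1 / 2 + t * I := by
  simp only [threeQuarterPt]
  push_cast
  ring

/-- [folklore] -/
theorem threeQuarterPt_injective : Function.Injective threeQuarterPt := by
  intro a b hab
  have h := congrArg Complex.im hab
  rw [threeQuarterPt_im, threeQuarterPt_im] at h
  linarith

/-- AN INTERIOR BAND WITH `θ = 1/2` INTEGERS (unconditional, Hardy): the level-`1/4` band of
`ζ(2s − 1)` contains `3/4 + it/2` for every critical zero `1/2 + it` of `ζ` — the line `σ = 3/4`
is populated (indeed by `≍ T log T` zeros; all of them under RH). [cite: Broucke2024, Thm 6.3] -/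
theorem bandSet_zetaRescaledHalf_infinite : (bandSet zetaRescaledHalf (1 / 4)).Infinite := by
  have hH : {t : ℝ | riemannZeta (1 / 2 + t * I) = 0}.Infinite :=
    Literature.NumberTheory.LFunctions.hardy_infinite_zeros_on_critical_line_holds
  have hsub : threeQuarterPt '' {t : ℝ | riemannZeta (1 / 2 + t * I) = 0}
      ⊆ bandSet zetaRescaledHalf (1 / 4) := by
    rintro _ ⟨t, ht, rfl⟩
    refine ⟨by rwa [zetaRescaledHalf, two_mul_threeQuarterPt_sub_one], ?_, ?_, ?_⟩ <;>
      rw [threeQuarterPt_re] <;> norm_num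
  exact (hH.image threeQuarterPt_injective.injOn).mono hsub

/-- The band shape fails for `ζ(2s − 1)`, through an INTERIOR line of the strip `(1/2, 1)`.
[cite: Broucke2024, Thm 6.3] -/
theorem not_band_zetaRescaledHalf : ¬ ∀ ε : ℝ, 0 < ε → (bandSet zetaRescaledHalf ε).Finite := fun h =>
  bandSet_zetaRescaledHalf_infinite (h _ (by norm_num))

/-- … and every window around `σ₀ = 3/4` carries infinitely many of its zeros (the interior half
of the crux, `Split.NoInteriorBandShape`, fails for it — stated here without that import).
[cite: Broucke2024, Thm 6.3] -/
theorem windows_zetaRescaledHalf_infinite {ε : ℝ} (hε : 0 < ε) :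
    {s : ℂ | zetaRescaledHalf s = 0 ∧ 0 < s.re ∧ s.re < 1 ∧ |s.re - 3 / 4| < ε}.Infinite := by
  have hH : {t : ℝ | riemannZeta (1 / 2 + t * I) = 0}.Infinite :=
    Literature.NumberTheory.LFunctions.hardy_infinite_zeros_on_critical_line_holds
  have hsub : threeQuarterPt '' {t : ℝ | riemannZeta (1 / 2 + t * I) = 0}
      ⊆ {s : ℂ | zetaRescaledHalf s = 0 ∧ 0 < s.re ∧ s.re < 1 ∧ |s.re - 3 / 4| < ε} := by
    rintro _ ⟨t, ht, rfl⟩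
    refine ⟨by rwa [zetaRescaledHalf, two_mul_threeQuarterPt_sub_one], ?_, ?_, ?_⟩ <;>
      rw [threeQuarterPt_re] <;> norm_num
    exact hε
  exact (hH.image threeQuarterPt_injective.injOn).mono hsub

end Summit.RiemannHypothesis.RiemannHypothesis.Theorems.AsymptoticCriticalLine.Negative
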